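import Summits.ResolutionOfSingularities.ResolutionOfSingularities.Theses.UniversalCells
import Summits.ResolutionOfSingularities.ResolutionOfSingularities.Theorems.MatroidCellRes.Negative.NonReducedGammaScheme
import Literature.AlgebraicGeometry.Resolution.PrincipalizationToResolution
import Literature.Barriers.ResolutionOfSingularities.InseparableBaseChangeResolution
import HarnessLib

/-!
# `MatroidCellRes` — negative lemma: the integrality hypothesis cannot be dropped
# (a non-reduced Γ-scheme with six columns)

Support (negative) lemma for crux stmt-ResolutionOfSingularities-15230
(`Summit.ResolutionOfSingularities.ResolutionOfSingularities.Theses.UniversalCells.MatroidCellRes`,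
route UniversalCells, rank 2: "every INTEGRAL scheme `W` with an open immersion `i` into a partial
matroid stratum `P(p,m,Γ₊,Γ₀) = Spec (𝔽_p[a_ij : 3 × m] ⧸ (Γ₀-minors of [I₃ | A]))[(∏_{Γ₊} minors)⁻¹]`
is pointwise-locally resolvable"), filed by the crux disprover (cdisprove seat). This file declares
no definition and no notation.

## Main statements

* `matroidCellRes_false_without_isIntegral` — the crux with the hypothesis `IsIntegral W` DROPPED is
  FALSE; `matroidCellRes_false_without_isIntegral_at` — a witness at every prime `p`.
* The witness (algebra in `Negative/NonReducedGammaScheme.lean`): `m = 3` (six columns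
  `e₀ e₁ e₂ c₀ c₁ c₂`), `Γ₊ = ∅`, `Γ₀ = {(c₀,c₁,c₂), (e₂,c₀,c₂), (e₁,e₂,c₂), (e₀,e₂,c₀), (e₀,e₁,c₁)}`,
  whose minors are `det A`, `a₀₀a₁₂ - a₀₂a₁₀`, `a₀₂`, `-a₁₀`, `a₂₁`. Modulo the three entries the
  ideal is `(x w, x z v + y w u)` in `x = a₀₀, y = a₀₁, z = a₁₁, w = a₁₂, u = a₂₀, v = a₂₂`:
  set-theoretically five coordinate 4-planes in `𝔸⁶`, but the plane `{x = w = 0}` carries, off the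
  other four, the DOUBLE structure `𝔽_p[y^±, u^±, z^±, v^±][x]/(x²)`. Concretely `f = y w u` is
  nilpotent and non-zero in every local ring of the stratum at a prime of `D(y u z v)`
  (`key_of_presentation`, by tangent vectors `S → (S ⧸ 𝔮)[ε]`), so that open is NOWHERE REDUCED
  (`nowhereReduced_basicOpen`); and a point with a nowhere-reduced neighbourhood has no resolvable
  neighbourhood, a resolution being an isomorphism over a dense — hence somewhere reduced — open
  (`not_exists_resolvable_nhd_of_nowhereReduced`, from
  `Literature…exists_dense_isReduced_of_hasResolution`).

## Reading for the provers / the route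

* The universal family of route UniversalCells is scheme-theoretically NON-REDUCED already at
  `n = 6` columns, with square-free `±1` cubic/quadratic equations, in every characteristic. Hu's
  hypothesis "`Z_Γ` integral" (Hu2025 Thm 1.3) and the crux's `IsIntegral W` exclude such strata —
  and they must: no integral (even reduced) `W` is open in `D(a₀₁a₂₀a₁₁a₂₂) ⊆ Z_{Γ₀}` here.
* The hypothesis can be WEAKENED to `IsReduced W` without leaving the shadow of the summit (the
  summit implies the crux for reduced `W`: disprover work file `Cruxes/MatroidCellRes/Disproof.lean`,
  `matroidCellResWith_isReduced_of_summit`), but not removed (this file). Companion: the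
  open-immersion hypothesis is load-bearing too (`Negative/OpenImmersionLoadBearing.lean`).

## Sources

Folklore (explicit computation). Analogous non-reducedness of ideals of adjacent `2 × 2` minors
is classical (Diaconis–Eisenbud–Sturmfels 1998; Hoşten–Sullivant 2004) and is not used.
-/

noncomputable section

-- single-problem summit: the doubled namespace component `ResolutionOfSingularities` is forced
set_option linter.dupNamespace false

open CategoryTheory AlgebraicGeometry TopologicalSpace Literature.AlgebraicGeometry.Resolution
open Literature.Barriers.ResolutionOfSingularities (exists_dense_isReduced_of_hasResolution)

namespace Summit.ResolutionOfSingularities.ResolutionOfSingularities.Theorems.MatroidCellRes.Negative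

/-! ## §1 Two general lemmas -/

/-- **A point with a nowhere-reduced neighbourhood has no resolvable neighbourhood.** If `w ∈ V`,
`V` open in `W`, and NO non-empty open `U ≤ V` is reduced, then no open `W' ∋ w` has a resolution:
a resolution of `W'` is an isomorphism over a dense open of `W'` with regular (hence reduced)
preimage (`exists_dense_isReduced_of_hasResolution`); that dense open meets `V`, and the
intersection would be a non-empty reduced open inside `V`. [folklore] -/
theorem not_exists_resolvable_nhd_of_nowhereReduced {W : Scheme.{0}} (w : W) (V : W.Opens)
    (hwV : w ∈ V)
    (hV : ∀ U : W.Opens, U ≤ V → (U : Set W).Nonempty → ¬ IsReduced (U : Scheme.{0})) :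
    ¬ ∃ W' : W.Opens, w ∈ W' ∧ Scheme.HasResolution (W' : Scheme.{0}) := by
  rintro ⟨W', hw, hres⟩
  obtain ⟨U, hUd, hUred⟩ := exists_dense_isReduced_of_hasResolution hres
  let x₀ : (W' : Scheme.{0}) := ⟨w, hw⟩
  have hx₀ : x₀ ∈ W'.ι ⁻¹ᵁ V := by
    show W'.ι.base x₀ ∈ (V : Set W)
    exact hwV
  obtain ⟨u, huU, huV⟩ := hUd.exists_mem_open (W'.ι ⁻¹ᵁ V).isOpen ⟨x₀, hx₀⟩
  have huV' : u.1 ∈ V := huV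
  let U₁ : W.Opens := (W'.ι ''ᵁ U) ⊓ V
  have hne : (U₁ : Set W).Nonempty :=
    ⟨u.1, (Scheme.Opens.mem_ι_image_iff W').mpr huU, huV'⟩
  have hle : U₁ ≤ V := inf_le_right
  haveI : IsReduced (U : Scheme.{0}) := hUred
  haveI : IsReduced ((W'.ι ''ᵁ U : W.Opens) : Scheme.{0}) :=
    isReduced_of_isOpenImmersion (W'.ι.isoImage U).inv
  haveI : IsReduced (U₁ : Scheme.{0}) :=
    isReduced_of_isOpenImmersion (W.homOfLE (inf_le_left : U₁ ≤ W'.ι ''ᵁ U))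
  exact hV U₁ hle hne this

/-- **Criterion for a nowhere-reduced basic open.** Let `f` be a nilpotent of a commutative ring `S`
and `g ∈ S`; suppose that for every prime `𝔮 ∌ g` the annihilator of `f` lies in `𝔮`. Then `f` is a
NON-ZERO nilpotent of every local ring `S_𝔮`, `𝔮 ∈ D(g)` (the stalk of `Spec S` is that local
ring), so no non-empty open subscheme of `D(g) ⊆ Spec S` is reduced. [folklore] -/
theorem nowhereReduced_basicOpen {S : Type} [CommRing S] (f g : S) (hf : IsNilpotent f)
    (key : ∀ q : PrimeSpectrum S, g ∉ q.asIdeal → ∀ s : S, s * f = 0 → s ∈ q.asIdeal) :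
    ∀ U : (Spec (.of S)).Opens, U ≤ PrimeSpectrum.basicOpen g →
      (U : Set (Spec (.of S))).Nonempty → ¬ IsReduced (U : Scheme.{0}) := by
  intro U hU ⟨u, hu⟩ hred
  have hgu : g ∉ u.asIdeal := hU hu
  -- the stalk of `U` at `u` is reduced, hence so is the stalk of `Spec S` at `u`
  let x : (U : Scheme.{0}) := ⟨u, hu⟩
  haveI : _root_.IsReduced ((U : Scheme.{0}).presheaf.stalk x) := inferInstance
  let e := (asIso (U.ι.stalkMap x)).commRingCatIsoToRingEquiv
  have hred' : _root_.IsReduced ((Spec (.of S)).presheaf.stalk u) :=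
    isReduced_of_injective e.toRingHom e.injective
  -- that stalk is the localisation of `S` at `u`
  let A : Type := (Spec.structureSheaf S).presheaf.stalk u
  haveI : _root_.IsReduced A := hred'
  have h0 : algebraMap S A f = 0 := (hf.map (algebraMap S A)).eq_zero
  obtain ⟨⟨s, hs⟩, hsf⟩ := (IsLocalization.map_eq_zero_iff u.asIdeal.primeCompl A f).mp h0
  exact hs (key u hgu s hsf)

/-! ## §2 The stratum `P(p, 3, ∅, Γ₀)` is nowhere reduced on `D(a₀₁ a₂₀ a₁₁ a₂₂)` -/

/-- **At every prime `p`: an open-immersed (indeed equal) `W` in the stratum `P(p,3,∅,Γ₀)` with a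
point no neighbourhood of which is resolvable.** `W` is the stratum itself, `i = 𝟙`, `w` any point
of the non-empty, nowhere-reduced open `D(a₀₁ a₂₀ a₁₁ a₂₂)` (`key_of_presentation` with the
presentation `exists_lift_stratumRing`/`ringHom_ext_stratumRing`; `nowhereReduced_basicOpen`;
`not_exists_resolvable_nhd_of_nowhereReduced`). [folklore] -/
theorem matroidCellRes_false_without_isIntegral_at (p : ℕ) (hp : p.Prime) :
    let M : Matrix (Fin 3) (Fin 3 ⊕ Fin 3) (MvPolynomial (Fin 3 × Fin 3) (ZMod p)) :=
      Matrix.fromCols 1 (Matrix.of fun i j => MvPolynomial.X (i, j))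
    let I : Ideal (MvPolynomial (Fin 3 × Fin 3) (ZMod p)) :=
      Ideal.span ((fun u : Fin 3 → Fin 3 ⊕ Fin 3 => (M.submatrix id u).det) ''
        ({![Sum.inr 0, Sum.inr 1, Sum.inr 2], ![Sum.inl 2, Sum.inr 0, Sum.inr 2],
        ![Sum.inl 1, Sum.inl 2, Sum.inr 2], ![Sum.inl 0, Sum.inl 2, Sum.inr 0],
        ![Sum.inl 0, Sum.inl 1, Sum.inr 1]} : Set (Fin 3 → Fin 3 ⊕ Fin 3)))
    ∃ (W : Scheme.{0})
      (i : W ⟶ Spec (.of (Localization.Away (Ideal.Quotient.mk I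
        (∏ u ∈ (∅ : Finset (Fin 3 → Fin 3 ⊕ Fin 3)), (M.submatrix id u).det)))))
      (w : W), IsOpenImmersion i ∧
        ¬ ∃ W' : W.Opens, w ∈ W' ∧ Scheme.HasResolution (W' : Scheme.{0}) := by
  intro M I
  haveI : Fact p.Prime := ⟨hp⟩
  -- the five generators die in the stratum ring
  have hι0 : ∀ a ∈ Ideal.span {MvPolynomial.X (0,0) * MvPolynomial.X (1,1) * MvPolynomial.X (2,2) - MvPolynomial.X (0,0) * MvPolynomial.X (1,2) * MvPolynomial.X (2,1)
        - MvPolynomial.X (0,1) * MvPolynomial.X (1,0) * MvPolynomial.X (2,2) + MvPolynomial.X (0,1) * MvPolynomial.X (1,2) * MvPolynomial.X (2,0)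
        + MvPolynomial.X (0,2) * MvPolynomial.X (1,0) * MvPolynomial.X (2,1) - MvPolynomial.X (0,2) * MvPolynomial.X (1,1) * MvPolynomial.X (2,0),
      MvPolynomial.X (0,0) * MvPolynomial.X (1,2) - MvPolynomial.X (0,2) * MvPolynomial.X (1,0), MvPolynomial.X (0,2), - MvPolynomial.X (1,0), MvPolynomial.X (2,1)},
      ((algebraMap _ (Localization.Away (Ideal.Quotient.mk I
        (∏ u ∈ (∅ : Finset (Fin 3 → Fin 3 ⊕ Fin 3)), (M.submatrix id u).det)))).comp
        (Ideal.Quotient.mk I)) a = 0 := by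
    intro a ha
    have hI : I = _ := gammaIdeal_example_eq p
    have h0 : Ideal.Quotient.mk I a = 0 := Ideal.Quotient.eq_zero_iff_mem.mpr (hI ▸ ha)
    rw [RingHom.comp_apply, h0, map_zero]
  have hneg : ∀ {S' : Type} [CommRing S'] (ι' : MvPolynomial (Fin 3 × Fin 3) (ZMod p) →+* S'),
      ι' (- MvPolynomial.X (1,0)) = 0 → ι' (MvPolynomial.X (1,0)) = 0 := by
    intro S' _ ι' h
    rwa [map_neg, neg_eq_zero] at h
  obtain ⟨hnil, ⟨w, hw⟩, hkey⟩ := key_of_presentation p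
    ((algebraMap _ (Localization.Away (Ideal.Quotient.mk I
      (∏ u ∈ (∅ : Finset (Fin 3 → Fin 3 ⊕ Fin 3)), (M.submatrix id u).det)))).comp
      (Ideal.Quotient.mk I))
    (hι0 _ (Ideal.subset_span (by simp))) (hι0 _ (Ideal.subset_span (by simp)))
    (hι0 _ (Ideal.subset_span (by simp))) (hneg _ (hι0 _ (Ideal.subset_span (by simp))))
    (hι0 _ (Ideal.subset_span (by simp)))
    (fun T _ ψ h1 h2 h3 h4 h5 => exists_lift_stratumRing p ψ h1 h2 h3 h4 h5)
    (fun T _ φ₁ φ₂ h => ringHom_ext_stratumRing p φ₁ φ₂ h)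
  have hV := nowhereReduced_basicOpen _ _ hnil hkey
  exact ⟨Spec (.of _), 𝟙 _, w, inferInstance,
    not_exists_resolvable_nhd_of_nowhereReduced w _ hw hV⟩

/-- **`IsIntegral W` is load-bearing in `MatroidCellRes`: it cannot be dropped.** The crux with the
hypothesis `IsIntegral W` REMOVED — "every scheme `W` open-immersed in a partial matroid stratum
`P(p,m,Γ₊,Γ₀)` over `𝔽_p` is pointwise-locally resolvable" — is FALSE: at `p = 2` (indeed at every
prime, `matroidCellRes_false_without_isIntegral_at`), `m = 3`, `Γ₊ = ∅` and
`Γ₀ = {(c₀,c₁,c₂), (e₂,c₀,c₂), (e₁,e₂,c₂), (e₀,e₂,c₀), (e₀,e₁,c₁)}` the stratum has a non-empty open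
that is nowhere reduced, while a resolution is an isomorphism over a dense — hence somewhere
reduced — open. So the universal family of the route is scheme-theoretically non-reduced already
at SIX columns, with square-free `±1` equations, in every characteristic; any proof of the crux must
use integrality, or at least reducedness (the summit implies the crux with `IsIntegral W` weakened
to `IsReduced W`). [folklore] -/
theorem matroidCellRes_false_without_isIntegral :
    ¬ ∀ p : ℕ, p.Prime → ∀ (m : ℕ) (Γp : Finset (Fin 3 → Fin 3 ⊕ Fin m))
        (Γ0 : Set (Fin 3 → Fin 3 ⊕ Fin m)),
      let M : Matrix (Fin 3) (Fin 3 ⊕ Fin m) (MvPolynomial (Fin 3 × Fin m) (ZMod p)) :=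
        Matrix.fromCols 1 (Matrix.of fun i j => MvPolynomial.X (i, j))
      let I : Ideal (MvPolynomial (Fin 3 × Fin m) (ZMod p)) :=
        Ideal.span ((fun u : Fin 3 → Fin 3 ⊕ Fin m => (M.submatrix id u).det) '' Γ0)
      ∀ (W : Scheme.{0})
        (i : W ⟶ Spec (.of (Localization.Away (Ideal.Quotient.mk I
          (∏ u ∈ Γp, (M.submatrix id u).det))))),
        IsOpenImmersion i → ∀ w : W, ∃ W' : W.Opens, w ∈ W' ∧
          Scheme.HasResolution (W' : Scheme.{0}) := by
  intro H
  obtain ⟨W, i, w, hi, hnot⟩ := matroidCellRes_false_without_isIntegral_at 2 Nat.prime_two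
  exact hnot (H 2 Nat.prime_two 3 ∅ _ W i hi w)

end Summit.ResolutionOfSingularities.ResolutionOfSingularities.Theorems.MatroidCellRes.Negative

end
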